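import Summits.QuantumFields.YangMills.Theorems.ThermalRulerRulerFromCruxes
import Summits.QuantumFields.YangMills.Theorems.ThermalRulerLinearDeconfinementWindow

/-!
# Birth skeleton (BC3) for crux `ThermalRulerBound` (stmt-QuantumFields-10413) — `Lines/birth.lean`

Registrar: `planner-skel-stmt-QuantumFields-10413-0` (skeleton-register one-shot; route
`route-QuantumFields-ThermalRuler`, re-audit bin REPAIRABLE), 2026-08-17.

Crux (route file `Theses/ThermalRuler.lean`, decl
`Summit.QuantumFields.YangMills.Theses.ThermalRuler.ThermalRulerBound`, rank 0, auto-crux of the route's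
target): for every compact connected second-countable `G`, continuous unitary `ρ : G →* M_n(ℂ)` (`0 < n`)
and central `z` with `ρ z = ω•1`, `ω ≠ 1`, there are `C, a` with: for `β ≥ 2`, `K₁ ≥ 2`, `K₂ ∈ (0,1]`,
STRONG EXPONENTIAL DECAY of 4D Wilson theory at `β` with constants `(K₁, K₂)` (Chatterjee 2021 Def. 2.3,
inlined over `QuantumLattice.ymSpecification`: all cubes, all boundary conditions, edge-local bounded
measurable observables) implies `K₂⁴·β ≤ C·log(βK₁/K₂)^a`.

## What is already in the tree (and therefore NOT a stub)

* the route's glue `Theorems.rulerFromCruxes_proof : LinearDeconfinementWindow → QuantCentreRestoration →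
  ThermalRulerBound` (item 11073, proved: `L₀ := ⌊β/C₀⌋₊` and real arithmetic);
* the Borgs–Seiler linear window `Theorems.LinearDeconfinementWindow_proof : LinearDeconfinementWindow`
  (item 11072, proved from `FiniteTemperature.SliceRP.infrared_bound_even`).
Consequently, on this line the crux IS the route's rank-3 crux `QuantCentreRestoration` (quantitative
Chatterjee: strong decay + `A·log(βK₁/K₂)^a ≤ K₂⁴·L₀` ⇒ no Polyakov long-range order on `ℤ³ × ℤ_{L₀}` at
couplings `(β, β)`), and `QuantCentreRestoration` as ONE stub is not admissible (`exact rulerFromCruxes_proof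
LinearDeconfinementWindow_proof h` closes `QuantCentreRestoration → ThermalRulerBound`). The skeleton
therefore cuts `QuantCentreRestoration` itself, along Chatterjee's mechanism run IN THE FINITE PERIODIC BOX.

## The cut: condition the periodic box `ℤ_{L₀} × (ℤ/L)³` on its time-zero spatial links

Let `μ` be the finite-temperature Gibbs measure (`FiniteTemperature.haar … |>.tilted (minusAction ρ β β)`,
whose expectations are the barrier file's `FiniteTemperature.expectation`, `integral_gibbs_eq_polyakovKernel`)
and `𝔖` the σ-algebra generated by the spatial links of the slice `t = 0`. Conditionally on `𝔖` the box is
a SLAB of thickness `L₀` whose two faces carry the same configuration. Then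
`G_L(x) = Re E[χ(P_0)χ̄(P_x)] = Re E[ Cov(χ(P_0), χ̄(P_x) | 𝔖) ] + Re E[ E[χ(P_0)|𝔖]·E[χ̄(P_x)|𝔖] ]`.

* `stub_sliceCentreSymmetry` (A, `M`, provable now): `E[χ(P_y) | 𝔖] = 0` a.e. — the centre transform
  (multiply every time-like link leaving the slice by `z`) preserves `μ` and `𝔖` and multiplies `χ(P_y)` by
  `ω ≠ 1`. Exact, every `β`, every volume; this is where the centre enters.
* `stub_boundaryInfluence` (B1, `L`, provable now): strong decay ⇒ changing a boundary condition at ONE edge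
  `e₂` moves the `γ_Λ(·|η)`-expectation of an observable at `e₁` by at most `C·β·K₁·e^{−K₂‖e₁−e₂‖}` —
  LINEAR in `βK₁` (Chatterjee 2021 Lemma 7.1 made quantitative; linearity, which needs `ρ(G)` connected, is
  what keeps the ruler's threshold polylogarithmic in `β`).
* `stub_slabDecorrelation` (B2, `XL`, load-bearing): strong decay + B1's influence bound + the threshold
  `A·log(βK₁/K₂)^a ≤ K₂⁴·L₀` ⇒ the conditional covariance `Cov(χ(P_0), χ̄(P_x) | 𝔖)` is a.e. `≤ ε` for
  `‖x‖ ≥ R(ε)`, uniformly in the (even) spatial volume — Chatterjee's block-resampling coupling of the slab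
  given its faces (his §§8–11 with explicit constants, block radius `r ≍ (L₀/4C₃)^{1/4}`).
* Proved here (no `sorry`): `abs_polyakovCorrelation_le_of_condCov` (A + B2 ⇒ `|G_L(x)| ≤ ε`: tilted-measure
  identity, `integral_condExp`, `E[χ(P_0)|𝔖]·E[χ̄(P_x)|𝔖] = 0` a.e.), `tendsto_zero_of_uniformly_small`
  (uniform smallness passes to every subsequential thermodynamic limit ⇒ `G∞ → 0` along `cofinite`),
  `quantCentreRestoration_of : A → B1 → B2 → QuantCentreRestoration` (via `exists_isThermodynamicLimit`), and
  `ThermalRulerBound_of : A → B1 → B2 → ThermalRulerBound := rulerFromCruxes_proof LinearDeconfinementWindow_proof ∘ …`.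

Neither stub is the crux or the summit in disguise: A is an exact finite-volume symmetry identity (no decay,
no `β`-dependence, no limit); B1 lives entirely in the `ℤ⁴`/boundary-condition vocabulary (no temperature, no
Polyakov loop); B2 concludes a CONDITIONAL covariance bound, which without A says nothing about `G_L`
(the product term `E[χ(P_0)|𝔖]·E[χ̄(P_x)|𝔖]` is exactly where long-range order sits in any model without
the centre symmetry, e.g. with centre-breaking matter) and without the limit passage and Borgs–Seiler nothing
about long-range order or `β`; none mentions OS data, schemes or `YangMills`. BC3 probes (registrar folder
`bc/probe2_{A,B1,B2}_to_{ThermalRulerBound,YangMills}.lean`, imports = the route file + ALL four landed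
`ThermalRuler*` Theorems so that `exact?` sees `rulerFromCruxes_proof`, `LinearDeconfinementWindow_proof`,
`rulerSoftens_proof`, the assembly; NOT this file; `maxHeartbeats 400000` per example, one tactic per example):
30/30 FAIL — `exact?` 6/6 "could not close the goal"; `aesop` 6/6 fail (2 exhaustive, 4 timeout); `simpa using h`
6/6 fail (2 type mismatch, 4 timeout); `simpa [Tgt] using h` 6/6 fail (1 mismatch, 5 timeout); `aesop (enableSimp :=
false)` after `unfold` 6/6 "failed to prove the goal after exhaustive search". The combined form `intro h; first |
exact? | simpa using h | (simpa [Tgt] using h) | aesop` (files `bc/probe_{A,B1,B2}_to_{ThermalRulerBound,YangMills}.lean`)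
fails 6/6 (A→YangMills: all alternatives fail, aesop exhaustive; the other five: timeout). Table of raw messages:
`Lines/birth.md`.

## Disproof used

None exists: `Cruxes/ThermalRulerBound/` had no workfiles before this one (no `Disproof.lean`, no
`Theorems/ThermalRulerBound/Negative/`); the negatives index of the summit (5 entries: RobustYangMillsRG,
MirrorModular, AdaptiveBlock, Multiboson ×2) contains nothing on finite-temperature / centre-symmetry /
boundary-influence statements. Refuter notes on the item (g43-3, g43-29) record that `simp/aesop/exact?`
batteries fail on the crux body and that every admissible `(G, ρ)` has `ρ(G)` a non-trivial CONNECTED compact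
Lie group — B1 uses exactly that (chains with small steps in `ρ(G)`).

`lean check`: rc 0, errors none; sorries = 3 = stubs (`stub_sliceCentreSymmetry`, `stub_boundaryInfluence`,
`stub_slabDecorrelation`), zero elsewhere; `#print axioms ThermalRulerBound_of` = `propext, Classical.choice,
Quot.sound`. Namespace `Summit.QuantumFields.YangMills.Cruxes.ThermalRulerBound.Birth`; the stub statements are
written over tree declarations with this file's `open Literature.MathematicalPhysics Literature.Barriers.QuantumFields`
in force, without `let`s or named arguments (so the registered signature text is the whole statement), and
`ThermalRulerBound_of` takes them under the by-name aliases `Stmt.stub_*` required by the skeleton audit (an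
`example` re-checks the literal `<A> → <B1> → <B2> → ThermalRulerBound` form).
-/

set_option autoImplicit false

noncomputable section

namespace Summit.QuantumFields.YangMills.Cruxes.ThermalRulerBound.Birth

open MeasureTheory Filter Topology
open scoped ComplexConjugate
open Literature.MathematicalPhysics Literature.Barriers.QuantumFields
open Literature.Barriers.QuantumFields.FiniteTemperature
open Summit.QuantumFields.YangMills.Theses.ThermalRuler
open Summit.QuantumFields.YangMills.Theorems

/-! ### The three stubs -/

/-- **Stub A — exact centre symmetry of the slice-conditioned finite-temperature measure
(`M`-sized, provable now).** For every compact group `G`, every continuous `ρ : G →* M_n(ℂ)`, every CENTRAL `z`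
with `ρ z = ω•1`, `ω ≠ 1`, every `d, L₀, L ≥ 1`, couplings `J_E, J_M` and spatial site `y`: the
conditional expectation of the traced Polyakov loop `χ(P_y)` given the σ-algebra `𝔖` generated by the
SPATIAL links of the time-zero slice vanishes `μ`-a.e., `μ` the finite-temperature Gibbs measure of the
periodic box `ℤ_{L₀} × (ℤ/L)^d` (tilted product Haar). Proof sketch (no mixing, every `β`, every volume):
the centre transform `T_z : U ↦ (z · U on the time-like links ((0, x), none), U elsewhere)` (i) preserves
`FiniteTemperature.haar` (left-invariance of `haarProbability` factor by factor), (ii) preserves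
`minusAction` (a time-like plaquette based at time `0` reads `zU₁ · U₂ · (zU₃)⁻¹ · U₄⁻¹ = U₁U₂U₃⁻¹U₄⁻¹`
because `z` is central; no other plaquette contains a time-`0` time-like link), hence preserves `μ`;
(iii) fixes every `𝔖`-measurable set (it does not touch spatial links); (iv) `P_y ∘ T_z = z · P_y`
(exactly one factor of the ordered product `timeHolonomy U L₀ (0, y)` sits at time `0`, also for `L₀ = 1`),
so `χ(P_y) ∘ T_z = tr(ρ z · ρ P_y) = ω · χ(P_y)`. Therefore `∫_s χ(P_y) dμ = ω ∫_s χ(P_y) dμ` for every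
`s ∈ 𝔖`, i.e. `∫_s χ(P_y) dμ = 0`, and `ae_eq_condExp_of_forall_setIntegral_eq` (with `g = 0`) gives the
claim (`μ` is a probability measure by `isProbabilityMeasure_tilted`; if `ρ` were not continuous the
statement is a junk-value triviality). This is the "exact centre symmetry of the slab measure with equal
faces" of the route's TWO-LAYER PLAN (`SliceBridge`), in finite volume. Size `M` (a measure-preserving
`MeasurableEquiv` like the barrier file's `originMulEquiv`, which does the one-link version at `J_E = 0`).
Leans on: `FiniteTemperature.{Config, haar, minusAction, polyakovTrace, timeHolonomy}`, Mathlib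
`Measure.tilted`, `MeasureTheory.condExp`, `MeasurableSpace.comap`. -/
theorem stub_sliceCentreSymmetry :
    ∀ (G : Type) [Group G] [TopologicalSpace G] [IsTopologicalGroup G] [CompactSpace G] [SecondCountableTopology G] [MeasurableSpace G] [BorelSpace G] (n : ℕ) (ρ : G →* Matrix (Fin n) (Fin n) ℂ) (z : G) (ω : ℂ), Continuous ρ → (∀ g : G, z * g = g * z) → ω ≠ 1 → ρ z = ω • (1 : Matrix (Fin n) (Fin n) ℂ) → ∀ (d L₀ L : ℕ) [NeZero L₀] [NeZero L] (JE JM : ℝ) (y : Fin d → ZMod L), MeasureTheory.condExp (MeasurableSpace.comap (fun (U : FiniteTemperature.Config d L₀ L G) (p : (Fin d → ZMod L) × Fin d) => U (((0 : ZMod L₀), p.1), some p.2)) inferInstance) ((FiniteTemperature.haar d L₀ L G).tilted (FiniteTemperature.minusAction ρ JE JM)) (fun U => FiniteTemperature.polyakovTrace ρ U y) =ᵐ[((FiniteTemperature.haar d L₀ L G).tilted (FiniteTemperature.minusAction ρ JE JM))] 0 := by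
  sorry

/-- **Stub B1 — single-edge boundary influence, LINEAR in `β K₁` (Chatterjee 2021 Lemma 7.1 made
quantitative; `L`-sized, provable now for connected `G`).** For every compact CONNECTED second-countable `G` and continuous unitary `ρ` (`0 < n`)
there is `C = C(G, ρ) > 0` such that for `β ≥ 2`, `K₁ ≥ 2`, `K₂ ∈ (0,1]`: IF Wilson's 4D theory has strong
exponential decay with constants `(K₁, K₂)` (the crux's inlined hypothesis, verbatim), THEN for every cube
`v + [0,M]⁴` with interior edge set `Λ` (verbatim the crux's cube), every two boundary conditions `η, η'`
that differ at a SINGLE edge `e₂` of the closed cube with `e₂ ∉ Λ`, every edge `e₁` of the closed cube and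
every measurable `f` bounded by `1` depending only on the plaquettes touching `e₁`:
`|∫ f dγ_Λ(·|η) − ∫ f dγ_Λ(·|η')| ≤ C·β·K₁·exp(−K₂‖e₁ − e₂‖)` (`γ_Λ = ymSpecification ρ β Λ ·`, sup-distance
of base points). Proof sketch: (a) TRANSPORT IDENTITY — if `f` does not depend on the edge `e₂`
(automatic when `‖e₁ − e₂‖ ≥ 2`), `E_{η'}[f] = E_η[f·e^{βΔ}] / E_η[e^{βΔ}]` with
`Δ(U) = Σ_{p ∋ e₂} (Re tr ρ(U_p[e₂ := η' e₂]) − Re tr ρ(U_p[e₂ := η e₂]))`, a cylinder function on the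
plaquettes touching `{e₂}` (at most 6 plaquettes, `|Δ| ≤ 12n`), so `E_{η'}[f] − E_η[f] = Cov_η(f, e^{βΔ})/E_η[e^{βΔ}]`;
(b) SMALL STEPS — because `ρ(G) ⊆ U(n)` is a compact CONNECTED Lie group, any two of its elements are joined
by a chain of `≤ D/δ + 1` elements of `ρ(G)` with consecutive operator-norm distance `≤ δ` (`D` = intrinsic
chain diameter of `ρ(G)`); take `δ = 1/(6nβ)` and preimages `η = η⁰, η¹, …, η^m = η'` (all `G`-valued, so
the decay hypothesis applies to EVERY intermediate boundary condition): each step has `|βΔ_j| ≤ 1`, hence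
`|e^{βΔ_j} − 1| ≤ (e−1)·|βΔ_j|`, the normalised `h_j = (e^{βΔ_j} − 1)/(e − 1)` is an admissible `g` in the
decay hypothesis (`e₂` is an edge of the closed cube), and `|E_{j+1}f − E_j f| ≤ e(e−1)·K₁e^{−K₂‖e₁−e₂‖}`;
(c) sum `m ≤ 6nDβ + 1 ≤ (6nD+1)β` steps: `C := e(e−1)(6nD+1)`; the near case `‖e₁ − e₂‖ ≤ 1` is trivial
(`|LHS| ≤ 2 ≤ C·4·e^{−1}`). LINEARITY IN `β` is the point: the one-step bound with a finite-energy factor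
`e^{24nβ}` (valid for every compact `G`, no connectedness) would put `β⁴` instead of `log(β)^a` into B2's
threshold and void the ruler — this is the quantitative content of "Chatterjee's Lemma 7.1 has `C₁ ∝ βK₁`"
in the route rationale, and the reason the crux carries `[ConnectedSpace G]`. Why it might fail: only
through conventions — (a) needs the DLR kernel `ymSpecification ρ β Λ η'` to be the `e^{βΔ}`-retilt of
`ymSpecification ρ β Λ η` transported along `U ↦ U[e₂ := η' e₂]` (true: both are `glueWith`-images of the same
product Haar, tilted by `−β·wilsonBoundaryAction`, and `Z_Λ(η) ∈ (0, ∞)` for continuous `ρ`), and the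
distance bookkeeping `‖e₁.1 − e₂.1‖` versus plaquette-set distance costs a factor `e^{2K₂} ≤ e²`, absorbed in
`C`. Size `L` (≈ 300–400 lines: the transport identity for `ymSpecification`, measurability of `Δ`,
telescoping, and the CHAIN LEMMA for `ρ(G)`: by the tree's von Neumann exponential chart
`Literature.Analysis.Calculus.exists_exp_chart_range ρ hρ` every `ρ(g)` with `‖ρ g − 1‖_F < r` is `exp X`
with `exp(ℝX) ⊆ ρ(G)` and `‖X‖_F ≤ 2‖ρ g − 1‖_F`, so it is joined to `1` inside `ρ(G)` by the `δ`-chain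
`exp((j/k)X)`, `k = ⌈‖X‖/δ⌉`; a CONNECTED compact group is generated by the `r`-ball around `1` in boundedly
many (`m₀`) factors (the generated subgroup is open, hence everything; compactness bounds the word length),
and left translation by unitaries is an isometry, whence chains of length `≤ m₀(2r/δ + 1)`, i.e.
`D = 2 r m₀`). Leans on: `QuantumLattice.{ymSpecification, wilsonBoundaryAction, plaquettesTouching,
plaquetteEdges, IsCylinder, glueWith}`, `isSpecification_ymSpecification_t2`
(LatticeGaugeDLRSpecificationProofs), `Literature.Analysis.Calculus.exists_exp_chart_range`
(ClosedSubgroupExpChart), Mathlib `Measure.tilted`, `Matrix.unitaryGroup`, `NormedSpace.exp`. -/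
theorem stub_boundaryInfluence :
    ∀ (G : Type) [Group G] [TopologicalSpace G] [IsTopologicalGroup G] [CompactSpace G] [SecondCountableTopology G] [MeasurableSpace G] [BorelSpace G] [ConnectedSpace G] (n : ℕ) (ρ : G →* Matrix (Fin n) (Fin n) ℂ), 0 < n → Continuous ρ → (∀ g, ρ g ∈ Matrix.unitaryGroup (Fin n) ℂ) → ∃ C : ℝ, 0 < C ∧ ∀ (β K₁ K₂ : ℝ), 2 ≤ β → 2 ≤ K₁ → 0 < K₂ → K₂ ≤ 1 → (∀ (M : ℕ) (v : Fin 4 → ℤ) (Λ : Finset (QuantumLattice.ZdEdge 4)) (η : QuantumLattice.LGConfig 4 G) (e₁ e₂ : QuantumLattice.ZdEdge 4) (f g : QuantumLattice.LGConfig 4 G → ℝ), Λ = (((Fintype.piFinset fun j : Fin 4 => Finset.Icc (v j) (v j + M)) ×ˢ (Finset.univ : Finset (Fin 4))).filter fun e => e.1 e.2 + 1 ≤ v e.2 + M ∧ ∀ j, j ≠ e.2 → v j < e.1 j ∧ e.1 j < v j + M) → (∀ j, v j ≤ e₁.1 j ∧ e₁.1 j ≤ v j + M) → e₁.1 e₁.2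 + 1 ≤ v e₁.2 + M → (∀ j, v j ≤ e₂.1 j ∧ e₂.1 j ≤ v j + M) → e₂.1 e₂.2 + 1 ≤ v e₂.2 + M → Measurable f → Measurable g → QuantumLattice.IsCylinder f ((QuantumLattice.plaquettesTouching {e₁}).biUnion QuantumLattice.plaquetteEdges) → QuantumLattice.IsCylinder g ((QuantumLattice.plaquettesTouching {e₂}).biUnion QuantumLattice.plaquetteEdges) → (∀ U, |f U| ≤ 1) → (∀ U, |g U| ≤ 1) → |(∫ U, f U * g U ∂(QuantumLattice.ymSpecification ρ β Λ η)) - (∫ U, f U ∂(QuantumLattice.ymSpecification ρ β Λ η)) * (∫ U, g U ∂(QuantumLattice.ymSpecification ρ β Λ η))| ≤ K₁ * Real.exp (-(K₂ * ‖e₁.1 - e₂.1‖))) → (∀ (M : ℕ) (v : Fin 4 → ℤ) (Λ : Finset (QuantumLattice.ZdEdge 4)) (η η' : QuantumLattice.LGConfig 4 G) (e₁ e₂ : QuantumLattice.ZdEdge 4) (f : QuantumLattice.LGConfig 4 G → ℝ), Λ = (((Fintype.piFinset fun j : Fin 4 => Finset.Icc (v j) (v j + M)) ×ˢ (Finset.univ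 : Finset (Fin 4))).filter fun e => e.1 e.2 + 1 ≤ v e.2 + M ∧ ∀ j, j ≠ e.2 → v j < e.1 j ∧ e.1 j < v j + M) → (∀ j, v j ≤ e₁.1 j ∧ e₁.1 j ≤ v j + M) → e₁.1 e₁.2 + 1 ≤ v e₁.2 + M → (∀ j, v j ≤ e₂.1 j ∧ e₂.1 j ≤ v j + M) → e₂.1 e₂.2 + 1 ≤ v e₂.2 + M → e₂ ∉ Λ → (∀ e, e ≠ e₂ → η e = η' e) → Measurable f → QuantumLattice.IsCylinder f ((QuantumLattice.plaquettesTouching {e₁}).biUnion QuantumLattice.plaquetteEdges) → (∀ U, |f U| ≤ 1) → |(∫ U, f U ∂(QuantumLattice.ymSpecification ρ β Λ η)) - (∫ U, f U ∂(QuantumLattice.ymSpecification ρ β Λ η'))| ≤ (C * β * K₁) * Real.exp (-(K₂ * ‖e₁.1 - e₂.1‖))) := by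
  sorry

/-- **Stub B2 — quantitative Chatterjee in the periodic box: the slab given its time-zero slice
decorrelates above the threshold `A·log(βK₁/K₂)^a ≤ K₂⁴·L₀` (`XL`, the load-bearing piece).**
For `(G, ρ)` as in B1 and every `C > 0` there are `A, a` such that for `β ≥ 2`, `K₁ ≥ 2`,
`K₂ ∈ (0,1]`: IF strong exponential decay holds with `(K₁, K₂)` (verbatim) AND the single-edge boundary
influence bound of B1 holds with constant `C·β·K₁` (verbatim B1's conclusion), THEN for every temporal extent
`L₀` with `A·log(βK₁/K₂)^a ≤ K₂⁴·L₀` and every `ε > 0` there is `R` such that for every even spatial box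
`(ℤ/(2k+2))³`, every `x ∈ ℤ³` in its fundamental domain with `‖x‖ ≥ R`: the conditional covariance of
`χ(P_0)` and `χ̄(P_x)` given the time-zero spatial slice `𝔖`,
`E[χ(P_0)χ̄(P_x)|𝔖] − E[χ(P_0)|𝔖]·E[χ̄(P_x)|𝔖]`, has norm `≤ ε` `μ`-a.e. (`μ`, `𝔖` as in A, at
`d = 3`, `J_E = J_M = β`). Mechanism (Chatterjee 2021 §§8–11 run in the periodic box with explicit
constants): conditionally on `𝔖` the box is the slab `{0,…,L₀} × (ℤ/L)³` with both faces equal to the slice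
configuration, a finite-volume Gibbs measure of the SAME specification (cubes of side `≤ L₀` not wrapping
around the torus have DLR kernels `ymSpecification ρ β Λ η`); B1 telescoped over the far faces of a cube of
side `r ≤ L₀/4` gives total-variation influence `≤ C'·r³·βK₁·e^{−K₂ r/2}` of the far boundary on its central
sub-cube; Chatterjee's block-resampling coupling of two slab configurations (same faces, independent
elsewhere) then lets disagreement cross a block with probability `≤ 1/2` as soon as
`C₁·L₀⁶·r³·e^{−K₂ r} ≤ 1/4` and `C₃·r⁴/L₀ ≤ 1/4` (his Lemma 11.1 with `C₂ = K₂`, `C₁ ∝ βK₁`, block radius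
re-optimised to `r ≍ (L₀/4C₃)^{1/4}` instead of `(log N)²`), which holds once `L₀ ≥ A·K₂⁻⁴·log(βK₁/K₂)^4`;
finally `‖Cov(χ(P_0), χ̄(P_x) | 𝔖)‖ ≤ 2n²·ℙ(disagreement percolates from x to 0) ≤ 2n²·e^{−c‖x‖/r} ≤ ε` for
`‖x‖ ≥ R(ε, L₀)`, uniformly in the slice configuration (strong decay is uniform in boundary conditions) and
in `L` (boxes with `‖x‖ ≤ k+1`, `‖x‖ ≥ R ≥ 2L₀` are automatically large). Why it might fail (= the crux's
recorded risk, now isolated): the global-update coupling pays entropy `N^{2d−2}·r^{d−1}` per step; if the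
`r`-optimisation cannot beat it the true threshold is `exp(c/K₂)` and the exponent pair `(4, a)` is dead
(the ruler shortens to `ξ_strong ≳ log β`); periodic space with IDENTICAL faces (instead of Chatterjee's free
slabs) and the `d = 3+1` bookkeeping are unprinted; the statement is for EVERY `C` (the constant of B1), so
`A` must absorb `log C`. Size `XL`. Leans on: everything B1 leans on, plus `FiniteTemperature.{haar,
minusAction, polyakovTrace}`, Mathlib `MeasureTheory.condExp`, `Measure.tilted`, `MeasurableSpace.comap`;
sources Chatterjee2021 = arXiv:2006.16229 (Def. 2.3, Thm 2.4, Lemmas 7.1–11.1), BorgsSeiler1983 (the window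
it is played against), MartinelliOlivieri1994 (why strong, not weak, mixing is the right hypothesis in `d ≥ 3`). -/
theorem stub_slabDecorrelation :
    ∀ (G : Type) [Group G] [TopologicalSpace G] [IsTopologicalGroup G] [CompactSpace G] [SecondCountableTopology G] [MeasurableSpace G] [BorelSpace G] [ConnectedSpace G] (n : ℕ) (ρ : G →* Matrix (Fin n) (Fin n) ℂ), 0 < n → Continuous ρ → (∀ g, ρ g ∈ Matrix.unitaryGroup (Fin n) ℂ) → ∀ C : ℝ, 0 < C → ∃ A : ℝ, ∃ a : ℕ, 0 < A ∧ ∀ (β K₁ K₂ : ℝ), 2 ≤ β → 2 ≤ K₁ → 0 < K₂ → K₂ ≤ 1 → (∀ (M : ℕ) (v : Fin 4 → ℤ) (Λ : Finset (QuantumLattice.ZdEdge 4)) (η : QuantumLattice.LGConfig 4 G) (e₁ e₂ : QuantumLattice.ZdEdge 4) (f g : QuantumLattice.LGConfig 4 G → ℝ), Λ = (((Fintype.piFinset fun j : Fin 4 => Finset.Icc (v j) (v j + M)) ×ˢ (Finset.univ : Finset (Fin 4))).filter fun e => e.1 e.2 + 1 ≤ v e.2 + M ∧ ∀ j, j ≠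 e.2 → v j < e.1 j ∧ e.1 j < v j + M) → (∀ j, v j ≤ e₁.1 j ∧ e₁.1 j ≤ v j + M) → e₁.1 e₁.2 + 1 ≤ v e₁.2 + M → (∀ j, v j ≤ e₂.1 j ∧ e₂.1 j ≤ v j + M) → e₂.1 e₂.2 + 1 ≤ v e₂.2 + M → Measurable f → Measurable g → QuantumLattice.IsCylinder f ((QuantumLattice.plaquettesTouching {e₁}).biUnion QuantumLattice.plaquetteEdges) → QuantumLattice.IsCylinder g ((QuantumLattice.plaquettesTouching {e₂}).biUnion QuantumLattice.plaquetteEdges) → (∀ U, |f U| ≤ 1) → (∀ U, |g U| ≤ 1) → |(∫ U, f U * g U ∂(QuantumLattice.ymSpecification ρ β Λ η)) - (∫ U, f U ∂(QuantumLattice.ymSpecification ρ β Λ η)) * (∫ U, g U ∂(QuantumLattice.ymSpecification ρ β Λ η))| ≤ K₁ * Real.exp (-(K₂ * ‖e₁.1 - e₂.1‖))) → (∀ (M : ℕ) (v : Fin 4 → ℤ) (Λ : Finset (QuantumLattice.ZdEdge 4)) (η η' : QuantumLattice.LGConfig 4 G) (e₁ e₂ : QuantumLattice.ZdEdge 4)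 (f : QuantumLattice.LGConfig 4 G → ℝ), Λ = (((Fintype.piFinset fun j : Fin 4 => Finset.Icc (v j) (v j + M)) ×ˢ (Finset.univ : Finset (Fin 4))).filter fun e => e.1 e.2 + 1 ≤ v e.2 + M ∧ ∀ j, j ≠ e.2 → v j < e.1 j ∧ e.1 j < v j + M) → (∀ j, v j ≤ e₁.1 j ∧ e₁.1 j ≤ v j + M) → e₁.1 e₁.2 + 1 ≤ v e₁.2 + M → (∀ j, v j ≤ e₂.1 j ∧ e₂.1 j ≤ v j + M) → e₂.1 e₂.2 + 1 ≤ v e₂.2 + M → e₂ ∉ Λ → (∀ e, e ≠ e₂ → η e = η' e) → Measurable f → QuantumLattice.IsCylinder f ((QuantumLattice.plaquettesTouching {e₁}).biUnion QuantumLattice.plaquetteEdges) → (∀ U, |f U| ≤ 1) → |(∫ U, f U ∂(QuantumLattice.ymSpecification ρ β Λ η)) - (∫ U, f U ∂(QuantumLattice.ymSpecification ρ β Λ η'))| ≤ (C * β * K₁) * Real.exp (-(K₂ * ‖e₁.1 - e₂.1‖))) → ∀ (L₀ : ℕ) [NeZero L₀], A * Real.log (β * K₁ / K₂) ^ a ≤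 K₂ ^ 4 * L₀ → ∀ ε : ℝ, 0 < ε → ∃ R : ℝ, ∀ (k : ℕ) (x : Fin 3 → ℤ), (∀ i, |x i| ≤ (k : ℤ) + 1) → R ≤ ‖x‖ → ∀ᵐ U ∂((FiniteTemperature.haar 3 L₀ (2 * k + 2) G).tilted (FiniteTemperature.minusAction ρ β β)), ‖MeasureTheory.condExp (MeasurableSpace.comap (fun (U : FiniteTemperature.Config 3 L₀ (2 * k + 2) G) (p : (Fin 3 → ZMod (2 * k + 2)) × Fin 3) => U (((0 : ZMod L₀), p.1), some p.2)) inferInstance) ((FiniteTemperature.haar 3 L₀ (2 * k + 2) G).tilted (FiniteTemperature.minusAction ρ β β)) (fun V => FiniteTemperature.polyakovTrace ρ V 0 * (starRingEnd ℂ) (FiniteTemperature.polyakovTrace ρ V (fun i => ((x i : ℤ) : ZMod (2 * k + 2))))) U - MeasureTheory.condExp (MeasurableSpace.comap (fun (U : FiniteTemperature.Config 3 L₀ (2 * k + 2) G) (p : (Fin 3 → ZMod (2 * k + 2)) × Fin 3) => U (((0 : ZMod L₀), p.1), some p.2)) inferInstance) ((FiniteTemperature.haar 3 L₀ (2 * k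 + 2) G).tilted (FiniteTemperature.minusAction ρ β β)) (fun V => FiniteTemperature.polyakovTrace ρ V 0) U * MeasureTheory.condExp (MeasurableSpace.comap (fun (U : FiniteTemperature.Config 3 L₀ (2 * k + 2) G) (p : (Fin 3 → ZMod (2 * k + 2)) × Fin 3) => U (((0 : ZMod L₀), p.1), some p.2)) inferInstance) ((FiniteTemperature.haar 3 L₀ (2 * k + 2) G).tilted (FiniteTemperature.minusAction ρ β β)) (fun V => (starRingEnd ℂ) (FiniteTemperature.polyakovTrace ρ V (fun i => ((x i : ℤ) : ZMod (2 * k + 2))))) U‖ ≤ ε := by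
  sorry

/-! ### Sorry-free glue: sliced Gibbs measure, kernel identity, limit passage -/

variable {G : Type} [Group G] [TopologicalSpace G] [IsTopologicalGroup G] [CompactSpace G]
  [SecondCountableTopology G] [MeasurableSpace G] [BorelSpace G] {n : ℕ}

/-- The σ-algebra generated by the SPATIAL links of the time-zero slice of `ℤ_{L₀} × (ℤ/L)^d`. -/
abbrev sliceMS (d L₀ L : ℕ) (G : Type) [MeasurableSpace G] : MeasurableSpace (Config d L₀ L G) :=
  MeasurableSpace.comap
    (fun (U : Config d L₀ L G) (p : (Fin d → ZMod L) × Fin d) => U (((0 : ZMod L₀), p.1), some p.2))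
    inferInstance

/-- The finite-temperature Gibbs probability measure of the periodic box, as a tilted product Haar
measure (its expectations are the barrier file's `FiniteTemperature.expectation`, see
`integral_gibbs_eq_polyakovKernel`). -/
abbrev gibbs (ρ : G →* Matrix (Fin n) (Fin n) ℂ) (d L₀ L : ℕ) [NeZero L₀] [NeZero L] (JE JM : ℝ) :
    Measure (Config d L₀ L G) :=
  (haar d L₀ L G).tilted (minusAction ρ JE JM)

omit [Group G] [TopologicalSpace G] [IsTopologicalGroup G] [CompactSpace G]
  [SecondCountableTopology G] [BorelSpace G] in
theorem measurable_sliceProj (d L₀ L : ℕ) :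
    Measurable (fun (U : Config d L₀ L G) (p : (Fin d → ZMod L) × Fin d) =>
      U (((0 : ZMod L₀), p.1), some p.2)) :=
  measurable_pi_lambda _ fun _ => measurable_pi_apply _

omit [Group G] [TopologicalSpace G] [IsTopologicalGroup G] [CompactSpace G]
  [SecondCountableTopology G] [BorelSpace G] in
theorem sliceMS_le (d L₀ L : ℕ) :
    sliceMS d L₀ L G ≤ (inferInstance : MeasurableSpace (Config d L₀ L G)) :=
  (measurable_sliceProj (G := G) d L₀ L).comap_le

/-- The Gibbs measure is a probability measure for a continuous representation. -/
theorem isProbabilityMeasure_gibbs (ρ : G →* Matrix (Fin n) (Fin n) ℂ) (hρ : Continuous ρ)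
    (d L₀ L : ℕ) [NeZero L₀] [NeZero L] (JE JM : ℝ) :
    IsProbabilityMeasure (gibbs ρ d L₀ L JE JM) :=
  isProbabilityMeasure_tilted (integrable_of_continuous (continuous_weight ρ hρ JE JM))

omit [SecondCountableTopology G] in
/-- Gibbs expectations of `χ(P_x) χ̄(P_y)` are the barrier file's complex Polyakov kernel. -/
theorem integral_gibbs_eq_polyakovKernel (ρ : G →* Matrix (Fin n) (Fin n) ℂ) {d L₀ L : ℕ}
    [NeZero L₀] [NeZero L] (JE JM : ℝ) (x y : Fin d → ZMod L) :
    ∫ U, polyakovTrace ρ U x * conj (polyakovTrace ρ U y) ∂(gibbs ρ d L₀ L JE JM) =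
      polyakovKernel (L₀ := L₀) ρ JE JM x y := by
  simp only [gibbs, polyakovKernel, integral_tilted, Complex.real_smul, Complex.ofReal_div]
  rw [← integral_div]
  refine integral_congr_ae (Eventually.of_forall fun U => ?_)
  simp only [weight]
  ring

/-- **From conditional decorrelation and centre symmetry to a bound on `G_L(x)`.**
`G_L(x) = Re E[χ(P_0)χ̄(P_x)] = Re E[ E[χ(P_0)χ̄(P_x) | slice] ]`, and the conditional expectation is
the conditional covariance plus `E[χ(P_0)|slice]·E[χ̄(P_x)|slice]`, whose first factor vanishes. -/
theorem abs_polyakovCorrelation_le_of_condCov (ρ : G →* Matrix (Fin n) (Fin n) ℂ)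
    (hρ : Continuous ρ) {d L₀ L : ℕ} [NeZero L₀] [NeZero L] (JE JM : ℝ) (x : Fin d → ZMod L)
    {ε : ℝ}
    (hcov : ∀ᵐ U ∂(gibbs ρ d L₀ L JE JM),
      ‖MeasureTheory.condExp (sliceMS d L₀ L G) (gibbs ρ d L₀ L JE JM)
            (fun V => polyakovTrace ρ V 0 * conj (polyakovTrace ρ V x)) U -
          MeasureTheory.condExp (sliceMS d L₀ L G) (gibbs ρ d L₀ L JE JM)
              (fun V => polyakovTrace ρ V 0) U *
            MeasureTheory.condExp (sliceMS d L₀ L G) (gibbs ρ d L₀ L JE JM)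
              (fun V => conj (polyakovTrace ρ V x)) U‖ ≤ ε)
    (hA : MeasureTheory.condExp (sliceMS d L₀ L G) (gibbs ρ d L₀ L JE JM)
        (fun V => polyakovTrace ρ V 0) =ᵐ[gibbs ρ d L₀ L JE JM] 0) :
    |polyakovCorrelation (L₀ := L₀) ρ JE JM x| ≤ ε := by
  haveI := isProbabilityMeasure_gibbs ρ hρ d L₀ L JE JM
  have hm := sliceMS_le (G := G) d L₀ L
  -- the conditional expectation of the product is a.e. bounded by `ε`
  have h1 : ∀ᵐ U ∂(gibbs ρ d L₀ L JE JM),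
      ‖MeasureTheory.condExp (sliceMS d L₀ L G) (gibbs ρ d L₀ L JE JM)
          (fun V => polyakovTrace ρ V 0 * conj (polyakovTrace ρ V x)) U‖ ≤ ε := by
    filter_upwards [hcov, hA] with U hU hU0
    rw [hU0, Pi.zero_apply, zero_mul, sub_zero] at hU
    exact hU
  have h2 := norm_integral_le_of_norm_le_const h1
  rw [probReal_univ, mul_one, integral_condExp hm, integral_gibbs_eq_polyakovKernel] at h2
  rw [polyakovCorrelation_eq_re_polyakovKernel ρ hρ JE JM x]
  exact (Complex.abs_re_le_norm _).trans h2

omit [SecondCountableTopology G] in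
/-- **Limit passage**: correlations that are uniformly (in the volume) small far away force every
subsequential thermodynamic limit to tend to `0` at spatial infinity. -/
theorem tendsto_zero_of_uniformly_small (ρ : G →* Matrix (Fin n) (Fin n) ℂ) {d L₀ : ℕ} [NeZero L₀]
    (JE JM : ℝ) {Ginf : (Fin d → ℤ) → ℝ}
    (hG : IsThermodynamicLimit (d := d) (L₀ := L₀) ρ JE JM Ginf)
    (hsmall : ∀ ε : ℝ, 0 < ε → ∃ R : ℝ, ∀ (k : ℕ) (x : Fin d → ℤ), (∀ i, |x i| ≤ (k : ℤ) + 1) →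
      R ≤ ‖x‖ → |polyakovCorrelation (L₀ := L₀) (L := 2 * k + 2) ρ JE JM
        (fun i => ((x i : ℤ) : ZMod (2 * k + 2)))| ≤ ε) :
    Tendsto Ginf cofinite (𝓝 0) := by
  rw [Metric.tendsto_nhds]
  intro ε hε
  obtain ⟨R, hR⟩ := hsmall (ε / 2) (half_pos hε)
  obtain ⟨φ, hφ, hlim⟩ := hG
  have hev : ∀ᶠ x : Fin d → ℤ in cofinite, R ≤ ‖x‖ :=
    (Literature.Barriers.QuantumFields.FiniteTemperature.tendsto_norm_cofinite_atTop (d := d)).eventually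
      (eventually_ge_atTop R)
  filter_upwards [hev] with x hx
  have hxk : ∀ᶠ k in atTop, ∀ i, |x i| ≤ (φ k : ℤ) + 1 := by
    have hsup : ∃ K : ℕ, ∀ i, |x i| ≤ K := by
      refine ⟨Finset.univ.sup fun i => (x i).natAbs, fun i => ?_⟩
      have : (x i).natAbs ≤ Finset.univ.sup fun i => (x i).natAbs :=
        Finset.le_sup (f := fun i => (x i).natAbs) (Finset.mem_univ i)
      calc |x i| = ((x i).natAbs : ℤ) := (Int.natCast_natAbs (x i)).symm
        _ ≤ _ := by exact_mod_cast this
    obtain ⟨K, hK⟩ := hsup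
    refine eventually_atTop.2 ⟨K, fun k hk i => (hK i).trans ?_⟩
    have : K ≤ φ k := hk.trans (hφ.id_le k)
    omega
  have hevk : ∀ᶠ k in atTop,
      |polyakovCorrelation (L₀ := L₀) (L := 2 * φ k + 2) ρ JE JM
          (fun i => ((x i : ℤ) : ZMod (2 * φ k + 2)))| ≤ ε / 2 :=
    hxk.mono fun k hk => hR (φ k) x hk hx
  have hb : |Ginf x| ≤ ε / 2 := le_of_tendsto ((continuous_abs.tendsto _).comp (hlim x)) hevk
  rw [Real.dist_0_eq_abs]
  linarith

/-! ### The composition -/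

/-- **The three stub statements imply the route's crux `QuantCentreRestoration`**: B1 discharges the
influence hypothesis of B2; B2 (conditional decorrelation of the slab) and A (centre symmetry of the
slice-conditioned measure: `E[χ(P_0) | slice] = 0`) bound `G_L(x)` uniformly in `L` beyond the
threshold (`abs_polyakovCorrelation_le_of_condCov`); the bound passes to every thermodynamic limit
(`tendsto_zero_of_uniformly_small`), contradicting Polyakov long-range order. -/
theorem quantCentreRestoration_of
    (hA : ∀ (G : Type) [Group G] [TopologicalSpace G] [IsTopologicalGroup G] [CompactSpace G] [SecondCountableTopology G] [MeasurableSpace G] [BorelSpace G] (n : ℕ) (ρ : G →* Matrix (Fin n) (Fin n) ℂ) (z : G) (ω : ℂ), Continuous ρ → (∀ g : G, z * g = g * z) → ω ≠ 1 → ρ z = ω • (1 : Matrix (Fin n) (Fin n) ℂ) → ∀ (d L₀ L : ℕ) [NeZero L₀] [NeZero L] (JE JM : ℝ) (y : Fin d → ZMod L), MeasureTheory.condExp (MeasurableSpace.comap (fun (U : FiniteTemperature.Config d L₀ L G) (p : (Fin d → ZMod L) × Fin d) => U (((0 : ZMod L₀), p.1), some p.2)) inferInstance) ((FiniteTemperature.haar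 d L₀ L G).tilted (FiniteTemperature.minusAction ρ JE JM)) (fun U => FiniteTemperature.polyakovTrace ρ U y) =ᵐ[((FiniteTemperature.haar d L₀ L G).tilted (FiniteTemperature.minusAction ρ JE JM))] 0)
    (hB1 : ∀ (G : Type) [Group G] [TopologicalSpace G] [IsTopologicalGroup G] [CompactSpace G] [SecondCountableTopology G] [MeasurableSpace G] [BorelSpace G] [ConnectedSpace G] (n : ℕ) (ρ : G →* Matrix (Fin n) (Fin n) ℂ), 0 < n → Continuous ρ → (∀ g, ρ g ∈ Matrix.unitaryGroup (Fin n) ℂ) → ∃ C : ℝ, 0 < C ∧ ∀ (β K₁ K₂ : ℝ), 2 ≤ β → 2 ≤ K₁ → 0 < K₂ → K₂ ≤ 1 → (∀ (M : ℕ) (v : Fin 4 → ℤ) (Λ : Finset (QuantumLattice.ZdEdge 4)) (η : QuantumLattice.LGConfig 4 G) (e₁ e₂ : QuantumLattice.ZdEdge 4) (f g : QuantumLattice.LGConfig 4 G → ℝ), Λ = (((Fintype.piFinset fun j : Fin 4 => Finset.Icc (v j) (v j + M)) ×ˢ (Finset.univ : Finset (Fin 4))).filter fun e => e.1 e.2 +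 1 ≤ v e.2 + M ∧ ∀ j, j ≠ e.2 → v j < e.1 j ∧ e.1 j < v j + M) → (∀ j, v j ≤ e₁.1 j ∧ e₁.1 j ≤ v j + M) → e₁.1 e₁.2 + 1 ≤ v e₁.2 + M → (∀ j, v j ≤ e₂.1 j ∧ e₂.1 j ≤ v j + M) → e₂.1 e₂.2 + 1 ≤ v e₂.2 + M → Measurable f → Measurable g → QuantumLattice.IsCylinder f ((QuantumLattice.plaquettesTouching {e₁}).biUnion QuantumLattice.plaquetteEdges) → QuantumLattice.IsCylinder g ((QuantumLattice.plaquettesTouching {e₂}).biUnion QuantumLattice.plaquetteEdges) → (∀ U, |f U| ≤ 1) → (∀ U, |g U| ≤ 1) → |(∫ U, f U * g U ∂(QuantumLattice.ymSpecification ρ β Λ η)) - (∫ U, f U ∂(QuantumLattice.ymSpecification ρ β Λ η)) * (∫ U, g U ∂(QuantumLattice.ymSpecification ρ β Λ η))| ≤ K₁ * Real.exp (-(K₂ * ‖e₁.1 - e₂.1‖))) → (∀ (M : ℕ) (v : Fin 4 → ℤ) (Λ : Finset (QuantumLattice.ZdEdge 4)) (η η' : QuantumLattice.LGConfig 4 G)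 (e₁ e₂ : QuantumLattice.ZdEdge 4) (f : QuantumLattice.LGConfig 4 G → ℝ), Λ = (((Fintype.piFinset fun j : Fin 4 => Finset.Icc (v j) (v j + M)) ×ˢ (Finset.univ : Finset (Fin 4))).filter fun e => e.1 e.2 + 1 ≤ v e.2 + M ∧ ∀ j, j ≠ e.2 → v j < e.1 j ∧ e.1 j < v j + M) → (∀ j, v j ≤ e₁.1 j ∧ e₁.1 j ≤ v j + M) → e₁.1 e₁.2 + 1 ≤ v e₁.2 + M → (∀ j, v j ≤ e₂.1 j ∧ e₂.1 j ≤ v j + M) → e₂.1 e₂.2 + 1 ≤ v e₂.2 + M → e₂ ∉ Λ → (∀ e, e ≠ e₂ → η e = η' e) → Measurable f → QuantumLattice.IsCylinder f ((QuantumLattice.plaquettesTouching {e₁}).biUnion QuantumLattice.plaquetteEdges) → (∀ U, |f U| ≤ 1) → |(∫ U, f U ∂(QuantumLattice.ymSpecification ρ β Λ η)) - (∫ U, f U ∂(QuantumLattice.ymSpecification ρ β Λ η'))| ≤ (C * β * K₁) * Real.exp (-(K₂ * ‖e₁.1 - e₂.1‖))))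
    (hB2 : ∀ (G : Type) [Group G] [TopologicalSpace G] [IsTopologicalGroup G] [CompactSpace G] [SecondCountableTopology G] [MeasurableSpace G] [BorelSpace G] [ConnectedSpace G] (n : ℕ) (ρ : G →* Matrix (Fin n) (Fin n) ℂ), 0 < n → Continuous ρ → (∀ g, ρ g ∈ Matrix.unitaryGroup (Fin n) ℂ) → ∀ C : ℝ, 0 < C → ∃ A : ℝ, ∃ a : ℕ, 0 < A ∧ ∀ (β K₁ K₂ : ℝ), 2 ≤ β → 2 ≤ K₁ → 0 < K₂ → K₂ ≤ 1 → (∀ (M : ℕ) (v : Fin 4 → ℤ) (Λ : Finset (QuantumLattice.ZdEdge 4)) (η : QuantumLattice.LGConfig 4 G) (e₁ e₂ : QuantumLattice.ZdEdge 4) (f g : QuantumLattice.LGConfig 4 G → ℝ), Λ = (((Fintype.piFinset fun j : Fin 4 => Finset.Icc (v j) (v j + M)) ×ˢ (Finset.univ : Finset (Fin 4))).filter fun e => e.1 e.2 + 1 ≤ v e.2 + M ∧ ∀ j, j ≠ e.2 → v j < e.1 j ∧ e.1 j < v j + M) → (∀ j, v j ≤ e₁.1 j ∧ e₁.1 j ≤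 v j + M) → e₁.1 e₁.2 + 1 ≤ v e₁.2 + M → (∀ j, v j ≤ e₂.1 j ∧ e₂.1 j ≤ v j + M) → e₂.1 e₂.2 + 1 ≤ v e₂.2 + M → Measurable f → Measurable g → QuantumLattice.IsCylinder f ((QuantumLattice.plaquettesTouching {e₁}).biUnion QuantumLattice.plaquetteEdges) → QuantumLattice.IsCylinder g ((QuantumLattice.plaquettesTouching {e₂}).biUnion QuantumLattice.plaquetteEdges) → (∀ U, |f U| ≤ 1) → (∀ U, |g U| ≤ 1) → |(∫ U, f U * g U ∂(QuantumLattice.ymSpecification ρ β Λ η)) - (∫ U, f U ∂(QuantumLattice.ymSpecification ρ β Λ η)) * (∫ U, g U ∂(QuantumLattice.ymSpecification ρ β Λ η))| ≤ K₁ * Real.exp (-(K₂ * ‖e₁.1 - e₂.1‖))) → (∀ (M : ℕ) (v : Fin 4 → ℤ) (Λ : Finset (QuantumLattice.ZdEdge 4)) (η η' : QuantumLattice.LGConfig 4 G) (e₁ e₂ : QuantumLattice.ZdEdge 4) (f : QuantumLattice.LGConfig 4 G → ℝ), Λ = (((Fintype.piFinset fun j : Fin 4 => Finset.Icc (v j)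 (v j + M)) ×ˢ (Finset.univ : Finset (Fin 4))).filter fun e => e.1 e.2 + 1 ≤ v e.2 + M ∧ ∀ j, j ≠ e.2 → v j < e.1 j ∧ e.1 j < v j + M) → (∀ j, v j ≤ e₁.1 j ∧ e₁.1 j ≤ v j + M) → e₁.1 e₁.2 + 1 ≤ v e₁.2 + M → (∀ j, v j ≤ e₂.1 j ∧ e₂.1 j ≤ v j + M) → e₂.1 e₂.2 + 1 ≤ v e₂.2 + M → e₂ ∉ Λ → (∀ e, e ≠ e₂ → η e = η' e) → Measurable f → QuantumLattice.IsCylinder f ((QuantumLattice.plaquettesTouching {e₁}).biUnion QuantumLattice.plaquetteEdges) → (∀ U, |f U| ≤ 1) → |(∫ U, f U ∂(QuantumLattice.ymSpecification ρ β Λ η)) - (∫ U, f U ∂(QuantumLattice.ymSpecification ρ β Λ η'))| ≤ (C * β * K₁) * Real.exp (-(K₂ * ‖e₁.1 - e₂.1‖))) → ∀ (L₀ : ℕ) [NeZero L₀], A * Real.log (β * K₁ / K₂) ^ a ≤ K₂ ^ 4 * L₀ → ∀ ε : ℝ, 0 < ε → ∃ R : ℝ, ∀ (k : ℕ) (x :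 Fin 3 → ℤ), (∀ i, |x i| ≤ (k : ℤ) + 1) → R ≤ ‖x‖ → ∀ᵐ U ∂((FiniteTemperature.haar 3 L₀ (2 * k + 2) G).tilted (FiniteTemperature.minusAction ρ β β)), ‖MeasureTheory.condExp (MeasurableSpace.comap (fun (U : FiniteTemperature.Config 3 L₀ (2 * k + 2) G) (p : (Fin 3 → ZMod (2 * k + 2)) × Fin 3) => U (((0 : ZMod L₀), p.1), some p.2)) inferInstance) ((FiniteTemperature.haar 3 L₀ (2 * k + 2) G).tilted (FiniteTemperature.minusAction ρ β β)) (fun V => FiniteTemperature.polyakovTrace ρ V 0 * (starRingEnd ℂ) (FiniteTemperature.polyakovTrace ρ V (fun i => ((x i : ℤ) : ZMod (2 * k + 2))))) U - MeasureTheory.condExp (MeasurableSpace.comap (fun (U : FiniteTemperature.Config 3 L₀ (2 * k + 2) G) (p : (Fin 3 → ZMod (2 * k + 2)) × Fin 3) => U (((0 : ZMod L₀), p.1), some p.2)) inferInstance) ((FiniteTemperature.haar 3 L₀ (2 * k + 2) G).tilted (FiniteTemperature.minusAction ρ β β)) (fun V => FiniteTemperature.polyakovTrace ρ V 0) U * MeasureTheory.condExp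 (MeasurableSpace.comap (fun (U : FiniteTemperature.Config 3 L₀ (2 * k + 2) G) (p : (Fin 3 → ZMod (2 * k + 2)) × Fin 3) => U (((0 : ZMod L₀), p.1), some p.2)) inferInstance) ((FiniteTemperature.haar 3 L₀ (2 * k + 2) G).tilted (FiniteTemperature.minusAction ρ β β)) (fun V => (starRingEnd ℂ) (FiniteTemperature.polyakovTrace ρ V (fun i => ((x i : ℤ) : ZMod (2 * k + 2))))) U‖ ≤ ε) :
    QuantCentreRestoration := by
  intro G _ _ _ _ _ _ _ _ n ρ z ω hn hρc hρu hz hω hρz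
  obtain ⟨C, hC, hinfl⟩ := hB1 G n ρ hn hρc hρu
  obtain ⟨A, a, hApos, hB'⟩ := hB2 G n ρ hn hρc hρu C hC
  refine ⟨A, a, hApos, ?_⟩
  intro β K₁ K₂ hβ hK₁ hK₂ hK₂1 hdec L₀ _ hthr hLRO
  obtain ⟨Ginf, hGinf⟩ := exists_isThermodynamicLimit (d := 3) (L₀ := L₀) ρ hρc hρu β β
  refine hLRO Ginf hGinf (tendsto_zero_of_uniformly_small ρ β β hGinf fun ε hε => ?_)
  obtain ⟨R, hR⟩ := hB' β K₁ K₂ hβ hK₁ hK₂ hK₂1 hdec (hinfl β K₁ K₂ hβ hK₁ hK₂ hK₂1 hdec)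
    L₀ hthr ε hε
  refine ⟨R, fun k x hxk hxR => ?_⟩
  exact abs_polyakovCorrelation_le_of_condCov ρ hρc β β _ (hR k x hxk hxR)
    (hA G n ρ z ω hρc hz hω hρz 3 L₀ (2 * k + 2) β β 0)

/-! ### The stub statements BY NAME

The skeleton audit (`ledger skeleton check`, `#h21_check_skeleton`) admits as hypotheses of the theorem
concluding the crux only propositions NAMED after a declared stub (head constant = a stub name). The three
aliases below are the stub statements verbatim (reducible), so that `ThermalRulerBound_of` can be stated in
hypothesis form over them; the `example` right after it re-checks the literal signatures. -/

namespace Stmt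

/-- The statement of `stub_sliceCentreSymmetry`, verbatim. -/
abbrev stub_sliceCentreSymmetry : Prop :=
  ∀ (G : Type) [Group G] [TopologicalSpace G] [IsTopologicalGroup G] [CompactSpace G] [SecondCountableTopology G] [MeasurableSpace G] [BorelSpace G] (n : ℕ) (ρ : G →* Matrix (Fin n) (Fin n) ℂ) (z : G) (ω : ℂ), Continuous ρ → (∀ g : G, z * g = g * z) → ω ≠ 1 → ρ z = ω • (1 : Matrix (Fin n) (Fin n) ℂ) → ∀ (d L₀ L : ℕ) [NeZero L₀] [NeZero L] (JE JM : ℝ) (y : Fin d → ZMod L), MeasureTheory.condExp (MeasurableSpace.comap (fun (U : FiniteTemperature.Config d L₀ L G) (p : (Fin d → ZMod L) × Fin d) => U (((0 : ZMod L₀), p.1), some p.2)) inferInstance) ((FiniteTemperature.haar d L₀ L G).tilted (FiniteTemperature.minusAction ρ JE JM)) (fun U => FiniteTemperature.polyakovTrace ρ U y) =ᵐ[((FiniteTemperature.haar d L₀ L G).tilted (FiniteTemperature.minusAction ρ JE JM))] 0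

/-- The statement of `stub_boundaryInfluence`, verbatim. -/
abbrev stub_boundaryInfluence : Prop :=
  ∀ (G : Type) [Group G] [TopologicalSpace G] [IsTopologicalGroup G] [CompactSpace G] [SecondCountableTopology G] [MeasurableSpace G] [BorelSpace G] [ConnectedSpace G] (n : ℕ) (ρ : G →* Matrix (Fin n) (Fin n) ℂ), 0 < n → Continuous ρ → (∀ g, ρ g ∈ Matrix.unitaryGroup (Fin n) ℂ) → ∃ C : ℝ, 0 < C ∧ ∀ (β K₁ K₂ : ℝ), 2 ≤ β → 2 ≤ K₁ → 0 < K₂ → K₂ ≤ 1 → (∀ (M : ℕ) (v : Fin 4 → ℤ) (Λ : Finset (QuantumLattice.ZdEdge 4)) (η : QuantumLattice.LGConfig 4 G) (e₁ e₂ : QuantumLattice.ZdEdge 4) (f g : QuantumLattice.LGConfig 4 G → ℝ), Λ = (((Fintype.piFinset fun j : Fin 4 => Finset.Icc (v j) (v j + M)) ×ˢ (Finset.univ : Finset (Fin 4))).filter fun e => e.1 e.2 + 1 ≤ v e.2 + M ∧ ∀ j, j ≠ e.2 → v j < e.1 j ∧ e.1 j < v j + M) → (∀ j, v j ≤ e₁.1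 j ∧ e₁.1 j ≤ v j + M) → e₁.1 e₁.2 + 1 ≤ v e₁.2 + M → (∀ j, v j ≤ e₂.1 j ∧ e₂.1 j ≤ v j + M) → e₂.1 e₂.2 + 1 ≤ v e₂.2 + M → Measurable f → Measurable g → QuantumLattice.IsCylinder f ((QuantumLattice.plaquettesTouching {e₁}).biUnion QuantumLattice.plaquetteEdges) → QuantumLattice.IsCylinder g ((QuantumLattice.plaquettesTouching {e₂}).biUnion QuantumLattice.plaquetteEdges) → (∀ U, |f U| ≤ 1) → (∀ U, |g U| ≤ 1) → |(∫ U, f U * g U ∂(QuantumLattice.ymSpecification ρ β Λ η)) - (∫ U, f U ∂(QuantumLattice.ymSpecification ρ β Λ η)) * (∫ U, g U ∂(QuantumLattice.ymSpecification ρ β Λ η))| ≤ K₁ * Real.exp (-(K₂ * ‖e₁.1 - e₂.1‖))) → (∀ (M : ℕ) (v : Fin 4 → ℤ) (Λ : Finset (QuantumLattice.ZdEdge 4)) (η η' : QuantumLattice.LGConfig 4 G) (e₁ e₂ : QuantumLattice.ZdEdge 4) (f : QuantumLattice.LGConfig 4 G → ℝ), Λ = (((Fintype.piFinset fun j : Fin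 4 => Finset.Icc (v j) (v j + M)) ×ˢ (Finset.univ : Finset (Fin 4))).filter fun e => e.1 e.2 + 1 ≤ v e.2 + M ∧ ∀ j, j ≠ e.2 → v j < e.1 j ∧ e.1 j < v j + M) → (∀ j, v j ≤ e₁.1 j ∧ e₁.1 j ≤ v j + M) → e₁.1 e₁.2 + 1 ≤ v e₁.2 + M → (∀ j, v j ≤ e₂.1 j ∧ e₂.1 j ≤ v j + M) → e₂.1 e₂.2 + 1 ≤ v e₂.2 + M → e₂ ∉ Λ → (∀ e, e ≠ e₂ → η e = η' e) → Measurable f → QuantumLattice.IsCylinder f ((QuantumLattice.plaquettesTouching {e₁}).biUnion QuantumLattice.plaquetteEdges) → (∀ U, |f U| ≤ 1) → |(∫ U, f U ∂(QuantumLattice.ymSpecification ρ β Λ η)) - (∫ U, f U ∂(QuantumLattice.ymSpecification ρ β Λ η'))| ≤ (C * β * K₁) * Real.exp (-(K₂ * ‖e₁.1 - e₂.1‖)))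

/-- The statement of `stub_slabDecorrelation`, verbatim. -/
abbrev stub_slabDecorrelation : Prop :=
  ∀ (G : Type) [Group G] [TopologicalSpace G] [IsTopologicalGroup G] [CompactSpace G] [SecondCountableTopology G] [MeasurableSpace G] [BorelSpace G] [ConnectedSpace G] (n : ℕ) (ρ : G →* Matrix (Fin n) (Fin n) ℂ), 0 < n → Continuous ρ → (∀ g, ρ g ∈ Matrix.unitaryGroup (Fin n) ℂ) → ∀ C : ℝ, 0 < C → ∃ A : ℝ, ∃ a : ℕ, 0 < A ∧ ∀ (β K₁ K₂ : ℝ), 2 ≤ β → 2 ≤ K₁ → 0 < K₂ → K₂ ≤ 1 → (∀ (M : ℕ) (v : Fin 4 → ℤ) (Λ : Finset (QuantumLattice.ZdEdge 4)) (η : QuantumLattice.LGConfig 4 G) (e₁ e₂ : QuantumLattice.ZdEdge 4) (f g : QuantumLattice.LGConfig 4 G → ℝ), Λ = (((Fintype.piFinset fun j : Fin 4 => Finset.Icc (v j) (v j + M)) ×ˢ (Finset.univ : Finset (Fin 4))).filter fun e => e.1 e.2 + 1 ≤ v e.2 + M ∧ ∀ j, j ≠ e.2 → v j < e.1 j ∧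 e.1 j < v j + M) → (∀ j, v j ≤ e₁.1 j ∧ e₁.1 j ≤ v j + M) → e₁.1 e₁.2 + 1 ≤ v e₁.2 + M → (∀ j, v j ≤ e₂.1 j ∧ e₂.1 j ≤ v j + M) → e₂.1 e₂.2 + 1 ≤ v e₂.2 + M → Measurable f → Measurable g → QuantumLattice.IsCylinder f ((QuantumLattice.plaquettesTouching {e₁}).biUnion QuantumLattice.plaquetteEdges) → QuantumLattice.IsCylinder g ((QuantumLattice.plaquettesTouching {e₂}).biUnion QuantumLattice.plaquetteEdges) → (∀ U, |f U| ≤ 1) → (∀ U, |g U| ≤ 1) → |(∫ U, f U * g U ∂(QuantumLattice.ymSpecification ρ β Λ η)) - (∫ U, f U ∂(QuantumLattice.ymSpecification ρ β Λ η)) * (∫ U, g U ∂(QuantumLattice.ymSpecification ρ β Λ η))| ≤ K₁ * Real.exp (-(K₂ * ‖e₁.1 - e₂.1‖))) → (∀ (M : ℕ) (v : Fin 4 → ℤ) (Λ : Finset (QuantumLattice.ZdEdge 4)) (η η' : QuantumLattice.LGConfig 4 G) (e₁ e₂ : QuantumLattice.ZdEdge 4) (f : QuantumLattice.LGConfig 4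 G → ℝ), Λ = (((Fintype.piFinset fun j : Fin 4 => Finset.Icc (v j) (v j + M)) ×ˢ (Finset.univ : Finset (Fin 4))).filter fun e => e.1 e.2 + 1 ≤ v e.2 + M ∧ ∀ j, j ≠ e.2 → v j < e.1 j ∧ e.1 j < v j + M) → (∀ j, v j ≤ e₁.1 j ∧ e₁.1 j ≤ v j + M) → e₁.1 e₁.2 + 1 ≤ v e₁.2 + M → (∀ j, v j ≤ e₂.1 j ∧ e₂.1 j ≤ v j + M) → e₂.1 e₂.2 + 1 ≤ v e₂.2 + M → e₂ ∉ Λ → (∀ e, e ≠ e₂ → η e = η' e) → Measurable f → QuantumLattice.IsCylinder f ((QuantumLattice.plaquettesTouching {e₁}).biUnion QuantumLattice.plaquetteEdges) → (∀ U, |f U| ≤ 1) → |(∫ U, f U ∂(QuantumLattice.ymSpecification ρ β Λ η)) - (∫ U, f U ∂(QuantumLattice.ymSpecification ρ β Λ η'))| ≤ (C * β * K₁) * Real.exp (-(K₂ * ‖e₁.1 - e₂.1‖))) → ∀ (L₀ : ℕ) [NeZero L₀], A * Real.log (β * K₁ / K₂) ^ a ≤ K₂ ^ 4 * L₀ → ∀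 ε : ℝ, 0 < ε → ∃ R : ℝ, ∀ (k : ℕ) (x : Fin 3 → ℤ), (∀ i, |x i| ≤ (k : ℤ) + 1) → R ≤ ‖x‖ → ∀ᵐ U ∂((FiniteTemperature.haar 3 L₀ (2 * k + 2) G).tilted (FiniteTemperature.minusAction ρ β β)), ‖MeasureTheory.condExp (MeasurableSpace.comap (fun (U : FiniteTemperature.Config 3 L₀ (2 * k + 2) G) (p : (Fin 3 → ZMod (2 * k + 2)) × Fin 3) => U (((0 : ZMod L₀), p.1), some p.2)) inferInstance) ((FiniteTemperature.haar 3 L₀ (2 * k + 2) G).tilted (FiniteTemperature.minusAction ρ β β)) (fun V => FiniteTemperature.polyakovTrace ρ V 0 * (starRingEnd ℂ) (FiniteTemperature.polyakovTrace ρ V (fun i => ((x i : ℤ) : ZMod (2 * k + 2))))) U - MeasureTheory.condExp (MeasurableSpace.comap (fun (U : FiniteTemperature.Config 3 L₀ (2 * k + 2) G) (p : (Fin 3 → ZMod (2 * k + 2)) × Fin 3) => U (((0 : ZMod L₀), p.1), some p.2)) inferInstance) ((FiniteTemperature.haar 3 L₀ (2 * k + 2) G).tilted (FiniteTemperature.minusAction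 ρ β β)) (fun V => FiniteTemperature.polyakovTrace ρ V 0) U * MeasureTheory.condExp (MeasurableSpace.comap (fun (U : FiniteTemperature.Config 3 L₀ (2 * k + 2) G) (p : (Fin 3 → ZMod (2 * k + 2)) × Fin 3) => U (((0 : ZMod L₀), p.1), some p.2)) inferInstance) ((FiniteTemperature.haar 3 L₀ (2 * k + 2) G).tilted (FiniteTemperature.minusAction ρ β β)) (fun V => (starRingEnd ℂ) (FiniteTemperature.polyakovTrace ρ V (fun i => ((x i : ℤ) : ZMod (2 * k + 2))))) U‖ ≤ ε

end Stmt

/-- **Composition `ThermalRulerBound_of : stub A → stub B1 → stub B2 → ThermalRulerBound`**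
(hypothesis form: the three stub STATEMENTS — by their `Stmt.*` names, i.e. verbatim — imply the crux
BY NAME; `sorry`-free). The route's proved glue `rulerFromCruxes_proof : LinearDeconfinementWindow →
QuantCentreRestoration → ThermalRulerBound` (Theorems/ThermalRulerRulerFromCruxes) and the proved support
`LinearDeconfinementWindow_proof` (Borgs–Seiler's linear window,
Theorems/ThermalRulerLinearDeconfinementWindow) reduce the crux to `QuantCentreRestoration`, which is
`quantCentreRestoration_of`. -/
theorem ThermalRulerBound_of :
    Stmt.stub_sliceCentreSymmetry → Stmt.stub_boundaryInfluence → Stmt.stub_slabDecorrelation →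
    ThermalRulerBound :=
  fun hA hB1 hB2 =>
    rulerFromCruxes_proof LinearDeconfinementWindow_proof (quantCentreRestoration_of hA hB1 hB2)

/-- Literal-signature check: `ThermalRulerBound_of` has the type
`<stub A statement> → <stub B1 statement> → <stub B2 statement> → <the route's crux decl>`, verbatim. -/
example :
    (∀ (G : Type) [Group G] [TopologicalSpace G] [IsTopologicalGroup G] [CompactSpace G] [SecondCountableTopology G] [MeasurableSpace G] [BorelSpace G] (n : ℕ) (ρ : G →* Matrix (Fin n) (Fin n) ℂ) (z : G) (ω : ℂ), Continuous ρ → (∀ g : G, z * g = g * z) → ω ≠ 1 → ρ z = ω • (1 : Matrix (Fin n) (Fin n) ℂ) → ∀ (d L₀ L : ℕ) [NeZero L₀] [NeZero L] (JE JM : ℝ) (y : Fin d → ZMod L), MeasureTheory.condExp (MeasurableSpace.comap (fun (U : FiniteTemperature.Config d L₀ L G) (p : (Fin d → ZMod L) × Fin d) => U (((0 : ZMod L₀), p.1), some p.2)) inferInstance) ((FiniteTemperature.haar d L₀ L G).tilted (FiniteTemperature.minusAction ρ JE JM)) (fun U => FiniteTemperature.polyakovTrace ρ U y) =ᵐ[((FiniteTemperature.haar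 d L₀ L G).tilted (FiniteTemperature.minusAction ρ JE JM))] 0) →
    (∀ (G : Type) [Group G] [TopologicalSpace G] [IsTopologicalGroup G] [CompactSpace G] [SecondCountableTopology G] [MeasurableSpace G] [BorelSpace G] [ConnectedSpace G] (n : ℕ) (ρ : G →* Matrix (Fin n) (Fin n) ℂ), 0 < n → Continuous ρ → (∀ g, ρ g ∈ Matrix.unitaryGroup (Fin n) ℂ) → ∃ C : ℝ, 0 < C ∧ ∀ (β K₁ K₂ : ℝ), 2 ≤ β → 2 ≤ K₁ → 0 < K₂ → K₂ ≤ 1 → (∀ (M : ℕ) (v : Fin 4 → ℤ) (Λ : Finset (QuantumLattice.ZdEdge 4)) (η : QuantumLattice.LGConfig 4 G) (e₁ e₂ : QuantumLattice.ZdEdge 4) (f g : QuantumLattice.LGConfig 4 G → ℝ), Λ = (((Fintype.piFinset fun j : Fin 4 => Finset.Icc (v j) (v j + M)) ×ˢ (Finset.univ : Finset (Fin 4))).filter fun e => e.1 e.2 + 1 ≤ v e.2 + M ∧ ∀ j, j ≠ e.2 → v j < e.1 j ∧ e.1 j < v j + M) → (∀ j, v j ≤ e₁.1 j ∧ e₁.1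 j ≤ v j + M) → e₁.1 e₁.2 + 1 ≤ v e₁.2 + M → (∀ j, v j ≤ e₂.1 j ∧ e₂.1 j ≤ v j + M) → e₂.1 e₂.2 + 1 ≤ v e₂.2 + M → Measurable f → Measurable g → QuantumLattice.IsCylinder f ((QuantumLattice.plaquettesTouching {e₁}).biUnion QuantumLattice.plaquetteEdges) → QuantumLattice.IsCylinder g ((QuantumLattice.plaquettesTouching {e₂}).biUnion QuantumLattice.plaquetteEdges) → (∀ U, |f U| ≤ 1) → (∀ U, |g U| ≤ 1) → |(∫ U, f U * g U ∂(QuantumLattice.ymSpecification ρ β Λ η)) - (∫ U, f U ∂(QuantumLattice.ymSpecification ρ β Λ η)) * (∫ U, g U ∂(QuantumLattice.ymSpecification ρ β Λ η))| ≤ K₁ * Real.exp (-(K₂ * ‖e₁.1 - e₂.1‖))) → (∀ (M : ℕ) (v : Fin 4 → ℤ) (Λ : Finset (QuantumLattice.ZdEdge 4)) (η η' : QuantumLattice.LGConfig 4 G) (e₁ e₂ : QuantumLattice.ZdEdge 4) (f : QuantumLattice.LGConfig 4 G → ℝ), Λ = (((Fintype.piFinset fun j : Fin 4 => Finset.Icc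 (v j) (v j + M)) ×ˢ (Finset.univ : Finset (Fin 4))).filter fun e => e.1 e.2 + 1 ≤ v e.2 + M ∧ ∀ j, j ≠ e.2 → v j < e.1 j ∧ e.1 j < v j + M) → (∀ j, v j ≤ e₁.1 j ∧ e₁.1 j ≤ v j + M) → e₁.1 e₁.2 + 1 ≤ v e₁.2 + M → (∀ j, v j ≤ e₂.1 j ∧ e₂.1 j ≤ v j + M) → e₂.1 e₂.2 + 1 ≤ v e₂.2 + M → e₂ ∉ Λ → (∀ e, e ≠ e₂ → η e = η' e) → Measurable f → QuantumLattice.IsCylinder f ((QuantumLattice.plaquettesTouching {e₁}).biUnion QuantumLattice.plaquetteEdges) → (∀ U, |f U| ≤ 1) → |(∫ U, f U ∂(QuantumLattice.ymSpecification ρ β Λ η)) - (∫ U, f U ∂(QuantumLattice.ymSpecification ρ β Λ η'))| ≤ (C * β * K₁) * Real.exp (-(K₂ * ‖e₁.1 - e₂.1‖)))) →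
    (∀ (G : Type) [Group G] [TopologicalSpace G] [IsTopologicalGroup G] [CompactSpace G] [SecondCountableTopology G] [MeasurableSpace G] [BorelSpace G] [ConnectedSpace G] (n : ℕ) (ρ : G →* Matrix (Fin n) (Fin n) ℂ), 0 < n → Continuous ρ → (∀ g, ρ g ∈ Matrix.unitaryGroup (Fin n) ℂ) → ∀ C : ℝ, 0 < C → ∃ A : ℝ, ∃ a : ℕ, 0 < A ∧ ∀ (β K₁ K₂ : ℝ), 2 ≤ β → 2 ≤ K₁ → 0 < K₂ → K₂ ≤ 1 → (∀ (M : ℕ) (v : Fin 4 → ℤ) (Λ : Finset (QuantumLattice.ZdEdge 4)) (η : QuantumLattice.LGConfig 4 G) (e₁ e₂ : QuantumLattice.ZdEdge 4) (f g : QuantumLattice.LGConfig 4 G → ℝ), Λ = (((Fintype.piFinset fun j : Fin 4 => Finset.Icc (v j) (v j + M)) ×ˢ (Finset.univ : Finset (Fin 4))).filter fun e => e.1 e.2 + 1 ≤ v e.2 + M ∧ ∀ j, j ≠ e.2 → v j < e.1 j ∧ e.1 j < v j + M) → (∀ j, v j ≤ e₁.1 j ∧ e₁.1 j ≤ v j +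 M) → e₁.1 e₁.2 + 1 ≤ v e₁.2 + M → (∀ j, v j ≤ e₂.1 j ∧ e₂.1 j ≤ v j + M) → e₂.1 e₂.2 + 1 ≤ v e₂.2 + M → Measurable f → Measurable g → QuantumLattice.IsCylinder f ((QuantumLattice.plaquettesTouching {e₁}).biUnion QuantumLattice.plaquetteEdges) → QuantumLattice.IsCylinder g ((QuantumLattice.plaquettesTouching {e₂}).biUnion QuantumLattice.plaquetteEdges) → (∀ U, |f U| ≤ 1) → (∀ U, |g U| ≤ 1) → |(∫ U, f U * g U ∂(QuantumLattice.ymSpecification ρ β Λ η)) - (∫ U, f U ∂(QuantumLattice.ymSpecification ρ β Λ η)) * (∫ U, g U ∂(QuantumLattice.ymSpecification ρ β Λ η))| ≤ K₁ * Real.exp (-(K₂ * ‖e₁.1 - e₂.1‖))) → (∀ (M : ℕ) (v : Fin 4 → ℤ) (Λ : Finset (QuantumLattice.ZdEdge 4)) (η η' : QuantumLattice.LGConfig 4 G) (e₁ e₂ : QuantumLattice.ZdEdge 4) (f : QuantumLattice.LGConfig 4 G → ℝ), Λ = (((Fintype.piFinset fun j : Fin 4 => Finset.Icc (v j) (v j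 + M)) ×ˢ (Finset.univ : Finset (Fin 4))).filter fun e => e.1 e.2 + 1 ≤ v e.2 + M ∧ ∀ j, j ≠ e.2 → v j < e.1 j ∧ e.1 j < v j + M) → (∀ j, v j ≤ e₁.1 j ∧ e₁.1 j ≤ v j + M) → e₁.1 e₁.2 + 1 ≤ v e₁.2 + M → (∀ j, v j ≤ e₂.1 j ∧ e₂.1 j ≤ v j + M) → e₂.1 e₂.2 + 1 ≤ v e₂.2 + M → e₂ ∉ Λ → (∀ e, e ≠ e₂ → η e = η' e) → Measurable f → QuantumLattice.IsCylinder f ((QuantumLattice.plaquettesTouching {e₁}).biUnion QuantumLattice.plaquetteEdges) → (∀ U, |f U| ≤ 1) → |(∫ U, f U ∂(QuantumLattice.ymSpecification ρ β Λ η)) - (∫ U, f U ∂(QuantumLattice.ymSpecification ρ β Λ η'))| ≤ (C * β * K₁) * Real.exp (-(K₂ * ‖e₁.1 - e₂.1‖))) → ∀ (L₀ : ℕ) [NeZero L₀], A * Real.log (β * K₁ / K₂) ^ a ≤ K₂ ^ 4 * L₀ → ∀ ε : ℝ, 0 < ε → ∃ R : ℝ, ∀ (k : ℕ) (x : Fin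 3 → ℤ), (∀ i, |x i| ≤ (k : ℤ) + 1) → R ≤ ‖x‖ → ∀ᵐ U ∂((FiniteTemperature.haar 3 L₀ (2 * k + 2) G).tilted (FiniteTemperature.minusAction ρ β β)), ‖MeasureTheory.condExp (MeasurableSpace.comap (fun (U : FiniteTemperature.Config 3 L₀ (2 * k + 2) G) (p : (Fin 3 → ZMod (2 * k + 2)) × Fin 3) => U (((0 : ZMod L₀), p.1), some p.2)) inferInstance) ((FiniteTemperature.haar 3 L₀ (2 * k + 2) G).tilted (FiniteTemperature.minusAction ρ β β)) (fun V => FiniteTemperature.polyakovTrace ρ V 0 * (starRingEnd ℂ) (FiniteTemperature.polyakovTrace ρ V (fun i => ((x i : ℤ) : ZMod (2 * k + 2))))) U - MeasureTheory.condExp (MeasurableSpace.comap (fun (U : FiniteTemperature.Config 3 L₀ (2 * k + 2) G) (p : (Fin 3 → ZMod (2 * k + 2)) × Fin 3) => U (((0 : ZMod L₀), p.1), some p.2)) inferInstance) ((FiniteTemperature.haar 3 L₀ (2 * k + 2) G).tilted (FiniteTemperature.minusAction ρ β β)) (fun V => FiniteTemperature.polyakovTrace ρ V 0) U * MeasureTheory.condExp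 (MeasurableSpace.comap (fun (U : FiniteTemperature.Config 3 L₀ (2 * k + 2) G) (p : (Fin 3 → ZMod (2 * k + 2)) × Fin 3) => U (((0 : ZMod L₀), p.1), some p.2)) inferInstance) ((FiniteTemperature.haar 3 L₀ (2 * k + 2) G).tilted (FiniteTemperature.minusAction ρ β β)) (fun V => (starRingEnd ℂ) (FiniteTemperature.polyakovTrace ρ V (fun i => ((x i : ℤ) : ZMod (2 * k + 2))))) U‖ ≤ ε) →
    Summit.QuantumFields.YangMills.Theses.ThermalRuler.ThermalRulerBound :=
  ThermalRulerBound_of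

/-- Registered form: the stubs BY NAME give the crux BY NAME (its only gaps are the three `sorry`s). -/
theorem ThermalRulerBound_of_stubs : ThermalRulerBound :=
  ThermalRulerBound_of stub_sliceCentreSymmetry stub_boundaryInfluence stub_slabDecorrelation

end Summit.QuantumFields.YangMills.Cruxes.ThermalRulerBound.Birth

end
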